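import Summits.ABC.StewartYu.PadicG3LevelsI
import Summits.ABC.StewartYu.PadicG3SiegelGen
import Summits.ABC.StewartYu.PadicG3Slab
import Summits.ABC.StewartYu.PadicG3Values
import HarnessLib

/-!
# Cell abc-stewartyu, crux `Y07Odd` (stmt-ABC-19658), line `gen3-slab-odd`: the START of the odd-`p` frame — Siegel's lemma on the slab class
# gives the level-`0` invariant (one sign class, interval box, slab depth)

`Summits/ABC/StewartYu/PadicG3Start.lean` — cell `abc-stewartyu` (seat p2-g4, F-odd lead).  Theorems on `G3Setup`; no named fact; no parameters.
The Matveev box `𝔅 = ∏[−s_j, s_j]` is cut by ONE pigeonhole (`PadicG3Slab.exists_slab_box`) to a twist∩slab class `𝔏` (`#𝔅 ≤ (p−1)p^m #𝔏`); the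
unknowns are `(ℓ₀, λ) ∈ [0, L₀] × 𝔏` with RELATIVE exponents `vᵢ = λ − λ♭` (`λ♭ ∈ 𝔏` fixed): one sign class (`cls vᵢ = 1`), slab depth
(`‖E vᵢ‖, ‖Lsum vᵢ − Lsum v_{i′}‖ ≤ p^{−(m+1)}` given `‖Λ/b_{j₀}‖ ≤ p^{−(m+1)}`), interval box `[−s − λ♭, s − λ♭]` of side `2s`; Siegel's lemma
(`PadicG3SiegelGen.exists_g3_siegel`) on the equations `|x| ≤ X₀`, `|τ| < T₀` yields the coefficients.  Record inputs: the count
`2·#E·(p−1)p^m ≤ (L₀+1)·∏(2s_j+1)`, the `Y₀`-weight data `(den₀, M₀)` for `ℓ₀ ≤ L₀`, the directional bound `Xb` on the box, and `Amax`.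

* `LvInvI.congr_R` — the invariant only sees the `Y₀`-polynomials through their Hasse values at integers;
* **`start`** — `∃ 𝔏 λ♭ pv, LvInvI R (unk L₀ 𝔏) (λ − λ♭) 1 pv (−s − λ♭) (2s) ⌈#unk·Amax⌉ m {|x| ≤ X₀} T₀`.

References: Yu. V. Nesterenko, LNM 1819 (2003) Prop. 3.9; K. Yu, Acta Arith. 89 (1999) p. 340 (the slab); Acta Math. 211 (2013) Lemma 4.2.
-/

noncomputable section

open NormedSpace Finset Polynomial
open Literature.NumberTheory.Transcendental
open Literature.NumberTheory.Transcendental.CW77.Setup (Tau tauNorm)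
open scoped Nat

namespace Summit.ABC.StewartYu

namespace G3Setup

variable {p : ℕ} [Fact p.Prime] {S : G3Setup p} {ι : Type*}

namespace LvInvI

/-- **The invariant only sees the `Y₀`-polynomials through their Hasse values at integer points.** [folklore] -/
theorem congr_R {R R' : ι → ℚ[X]} {B : Finset ι} {v : ι → Fin S.n → ℤ} {sgn pv : ι → ℤ} {lo : Fin S.n → ℤ} {L : Fin S.n → ℕ}
    {P : ℤ} {m : ℕ} {Xs : Set ℤ} {T : ℕ} (h : S.LvInvI R B v sgn pv lo L P m Xs T)
    (hRR' : ∀ i ∈ B, ∀ (t : ℕ) (x : ℤ), (hasseDeriv t (R i)).eval (x : ℚ) = (hasseDeriv t (R' i)).eval (x : ℚ)) :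
    S.LvInvI R' B v sgn pv lo L P m Xs T := by
  refine ⟨h.nonzero, h.bound, h.lo_le, h.box, h.sgn_pm, h.cls, h.depth, h.slab, fun x hx τ hτ => ?_⟩
  have hv := h.vanish x hx τ hτ
  unfold g3φ at hv ⊢
  rw [← hv]
  exact sum_congr rfl fun i hi => by rw [hRR' i hi]

end LvInvI

variable (S)

/-- `cls(λ − λ′) = 1` on a twist class. [folklore] -/
theorem cls_sub_eq_one {𝔏 : Finset (Fin S.n → ℤ)} (h𝔏 : S.IsTwistClass 𝔏) {lam lam' : Fin S.n → ℤ} (hl : lam ∈ 𝔏) (hl' : lam' ∈ 𝔏) :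
    S.cls (lam - lam') = 1 := by
  have hc := h𝔏 lam hl lam' hl'
  have hne : S.cls lam' ≠ 0 := by
    have := S.norm_cls lam'
    intro h0; rw [h0, norm_zero] at this; exact zero_ne_one this
  have hmul : S.cls (lam - lam') * S.cls lam' = S.cls lam := by
    unfold cls
    rw [← prod_mul_distrib]
    refine prod_congr rfl fun j _ => ?_
    rw [← zpow_add₀ (S.η_ne j)]
    simp only [Pi.sub_apply, sub_add_cancel]
  rw [hc] at hmul
  exact mul_left_eq_self₀.mp hmul |>.resolve_right hne

/-- Slab depth of the relative exponents: `‖E(λ − λ♭)‖ ≤ p^{−(m+1)}` on a slab class if `‖Λ/b_{j₀}‖ ≤ p^{−(m+1)}`. [folklore] -/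
theorem norm_E_sub_le_depth {m : ℕ} {𝔏 : Finset (Fin S.n → ℤ)} (h𝔏 : S.IsSlab m 𝔏) {lam lam' : Fin S.n → ℤ} (hl : lam ∈ 𝔏)
    (hl' : lam' ∈ 𝔏) (hΛm : ‖S.Λ / (S.b S.j₀ : ℚ_[p])‖ ≤ (p : ℝ)⁻¹ ^ (m + 1)) :
    ‖S.E (lam - lam')‖ ≤ (p : ℝ)⁻¹ ^ (m + 1) := by
  rw [S.E_sub]
  refine (S.norm_E_sub_le lam lam').trans (max_le ?_ hΛm)
  rw [S.Lsum_sub]; exact h𝔏 lam hl lam' hl'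

/-- **THE START (level `0`).**  Siegel's lemma on the twist∩slab class. [cite: Nesterenko2003, Prop 3.9] [cite: Yu1999, p. 340] -/
theorem start (m : ℕ) (s : Fin S.n → ℕ) (L₀ : ℕ) (R : ℕ → ℚ[X]) (X₀ T₀ : ℕ) (hT₀ : 1 ≤ T₀)
    (hΛm : ‖S.Λ / (S.b S.j₀ : ℚ_[p])‖ ≤ (p : ℝ)⁻¹ ^ (m + 1))
    (E : Finset (ℤ × Tau S.n)) (hEdef : E = Icc (-(X₀ : ℤ)) X₀ ×ˢ CW77.Setup.tauSet S.n T₀)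
    (hcount : 2 * E.card * ((p - 1) * p ^ m) ≤ (L₀ + 1) * ∏ j, (2 * s j + 1))
    (den₀ : ℤ × Tau S.n → ℕ) (hden₀ : ∀ e ∈ E, 1 ≤ den₀ e) (M₀ : ℤ × Tau S.n → ℤ)
    (hR : ∀ e ∈ E, ∀ ℓ₀ ≤ L₀, ∃ z₀ : ℤ, (den₀ e : ℚ) * (hasseDeriv e.2.1 (R ℓ₀)).eval (e.1 : ℚ) = z₀ ∧ |z₀| ≤ M₀ e)
    {Xb : ℤ} (hX : ∀ lam ∈ S.box s, ∀ lam' ∈ S.box s, ∀ k, |S.𝔛 (lam - lam') k| ≤ Xb)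
    {Amax : ℝ} (hAmax : 1 ≤ Amax)
    (hA : ∀ e ∈ E, (M₀ e : ℝ) * (Xb : ℝ) ^ (∑ k, e.2.2 k) *
      ((MonomialDen.monDen S.α (S.boxExpG (fun j => 2 * s j) e.1) : ℝ)) ^ 2 ≤ Amax) :
    ∃ (𝔏 : Finset (Fin S.n → ℤ)) (lamb : Fin S.n → ℤ) (pv : ℕ × (Fin S.n → ℤ) → ℤ),
      𝔏 ⊆ S.box s ∧ lamb ∈ 𝔏 ∧
      S.LvInvI (fun i => R i.1) (S.unk L₀ 𝔏) (fun i => i.2 - lamb) (fun _ => 1) pv (fun j => -(s j : ℤ) - lamb j) (fun j => 2 * s j)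
        ⌈((S.unk L₀ 𝔏).card : ℝ) * Amax⌉ m {x : ℤ | |x| ≤ (X₀ : ℤ)} T₀ := by
  classical
  have hp : p.Prime := Fact.out
  obtain ⟨𝔏, h𝔏box, htw, hslab, hcard𝔏⟩ := S.exists_slab_box m s
  -- the class is non-empty
  have hprod : 1 ≤ ∏ j, (2 * s j + 1) := Finset.one_le_prod' fun j _ => by omega
  have hpm : 0 < (p - 1) * p ^ m := Nat.mul_pos (by have := S.hp3; omega) (pow_pos hp.pos m)
  have h𝔏ne : 𝔏.Nonempty := by
    rw [← Finset.card_pos]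
    by_contra h0
    push Not at h0
    have : 𝔏.card = 0 := by omega
    rw [this, mul_zero] at hcard𝔏
    omega
  obtain ⟨lamb, hlamb⟩ := h𝔏ne
  -- Siegel
  have hE : E.Nonempty := by
    refine ⟨((0 : ℤ), ((0 : ℕ), fun _ => (0 : ℕ))), ?_⟩
    rw [hEdef, mem_product, mem_Icc, CW77.Setup.mem_tauSet]
    refine ⟨⟨by omega, by omega⟩, ?_⟩
    unfold tauNorm; simp; omega
  have hcard : 2 * E.card ≤ (S.unk L₀ 𝔏).card := by
    rw [S.card_unk]
    have h1 : (L₀ + 1) * ∏ j, (2 * s j + 1) ≤ (L₀ + 1) * ((p - 1) * p ^ m * 𝔏.card) := Nat.mul_le_mul_left _ hcard𝔏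
    have h2 : 2 * E.card * ((p - 1) * p ^ m) ≤ ((L₀ + 1) * 𝔏.card) * ((p - 1) * p ^ m) := by
      calc 2 * E.card * ((p - 1) * p ^ m) ≤ (L₀ + 1) * ((p - 1) * p ^ m * 𝔏.card) := hcount.trans h1
        _ = ((L₀ + 1) * 𝔏.card) * ((p - 1) * p ^ m) := by ring
    exact Nat.le_of_mul_le_mul_right h2 hpm
  have hvbox : ∀ i ∈ S.unk L₀ 𝔏, ∀ j, |(i.2 - lamb) j| ≤ ((2 * s j : ℕ) : ℤ) := by
    intro i hi j
    have hi2 : i.2 ∈ S.box s := h𝔏box ((mem_product.mp (by unfold unk at hi; exact hi)).2)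
    have h1 := S.mem_box.mp hi2 j
    have h2 := S.mem_box.mp (h𝔏box hlamb) j
    simp only [Pi.sub_apply]
    rw [abs_le] at h1 h2 ⊢
    push_cast
    constructor <;> omega
  have hRB : ∀ e ∈ E, ∀ i ∈ S.unk L₀ 𝔏,
      ∃ z₀ : ℤ, (den₀ e : ℚ) * (hasseDeriv e.2.1 (R i.1)).eval (e.1 : ℚ) = z₀ ∧ |z₀| ≤ M₀ e := by
    intro e he i hi
    have hi1 : i.1 ≤ L₀ := by
      unfold unk at hi
      have := (mem_product.mp hi).1
      rw [mem_range] at this; omega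
    exact hR e he i.1 hi1
  have hXB : ∀ i ∈ S.unk L₀ 𝔏, ∀ k, |S.𝔛 (i.2 - lamb) k| ≤ Xb := by
    intro i hi k
    unfold unk at hi
    exact hX i.2 (h𝔏box (mem_product.mp hi).2) lamb (h𝔏box hlamb) k
  obtain ⟨pv, hsupp, hne, hbd, hsol⟩ := S.exists_g3_siegel (fun i : ℕ × (Fin S.n → ℤ) => R i.1) (fun i => i.2 - lamb)
    (S.unk L₀ 𝔏) E hE hcard hvbox den₀ hden₀ M₀ hRB hXB hAmax hA
  refine ⟨𝔏, lamb, pv, h𝔏box, hlamb, ?_⟩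
  obtain ⟨i₀, hi₀⟩ := hne
  refine ⟨⟨i₀, hsupp i₀ hi₀, hi₀⟩, fun i _ => hbd i, ?_, ?_, fun _ => Or.inl rfl, ?_, ?_, ?_, ?_⟩
  · -- the interval contains 0
    intro j
    have h2 := S.mem_box.mp (h𝔏box hlamb) j
    rw [abs_le] at h2
    push_cast
    constructor <;> omega
  · -- interval box
    intro i hi j
    have hi2 : i.2 ∈ S.box s := h𝔏box ((mem_product.mp (by unfold unk at hi; exact hi)).2)
    have h1 := S.mem_box.mp hi2 j
    rw [abs_le] at h1
    simp only [Pi.sub_apply]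
    push_cast
    constructor <;> omega
  · -- one sign class
    intro i hi
    have hi2 : i.2 ∈ 𝔏 := (mem_product.mp (by unfold unk at hi; exact hi)).2
    rw [S.cls_sub_eq_one htw hi2 hlamb]; norm_num
  · -- depth
    intro i hi
    have hi2 : i.2 ∈ 𝔏 := (mem_product.mp (by unfold unk at hi; exact hi)).2
    exact S.norm_E_sub_le_depth hslab hi2 hlamb hΛm
  · -- slab
    intro i hi i' hi'
    have hi2 : i.2 ∈ 𝔏 := (mem_product.mp (by unfold unk at hi; exact hi)).2
    have hi2' : i'.2 ∈ 𝔏 := (mem_product.mp (by unfold unk at hi'; exact hi')).2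
    rw [← S.Lsum_sub]
    have : i.2 - lamb - (i'.2 - lamb) = i.2 - i'.2 := by abel
    rw [this, S.Lsum_sub]
    exact hslab i.2 hi2 i'.2 hi2'
  · -- vanishing (sign class `1`: `pvx 1 pv x = pv`)
    intro x hx τ hτ
    have hpvx : pvx (fun _ : ℕ × (Fin S.n → ℤ) => (1 : ℤ)) pv x = pv := by
      funext i; unfold pvx; rw [one_pow, one_mul]
    rw [hpvx]
    have he : (x, τ) ∈ E := by
      rw [hEdef, mem_product, mem_Icc, CW77.Setup.mem_tauSet]
      have hx' : |x| ≤ (X₀ : ℤ) := hx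
      rw [abs_le] at hx'
      exact ⟨⟨hx'.1, hx'.2⟩, hτ⟩
    exact hsol (x, τ) he

end G3Setup

end Summit.ABC.StewartYu

end
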